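import Summits.CriticalPhenomena.Ising3D.Control2DCellSound
import Mathlib.Tactic.NormNum
import HarnessLib

/-!
# The 2D control: soundness of the kernel checker for obligation (C) — cells and cut lists
(cell `pub-ising3x`, seat controls-1; companion of `Control2DCellSound.lean`)

HONEST FRAMING: lottery ticket; floor = tightest certified 3D Ising CFT bounds; no exact-solution
claim without a proof.

From the point enclosures of `Control2DCellSound.lean`: the four cell sums bound the frozen sums
(`sums4_spec`), one cell (`PsiC_nonneg_of_cellOKC`, via `Control2DCellScheme.PsiC_nonneg_on_cell`), a
cut list (`checkSpin_sound`: if `checkSpin` passes then `Ψ = φ[F_-[Q_N]] ≥ 0` on `[T₀, T_K]`), and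
with the truncation bound obligation (C) on that range (`cellPositive_of_checkSpin`, for any point
functional at `Δ_σ = 1/8` with rational nodes whose above-threshold obligation holds). All PROVED.
-/

namespace Summit.CriticalPhenomena.Ising3D.Control2D

open Set Finset
open Literature.MathematicalPhysics.QuantumFieldTheory.ConformalBootstrap3D

/-! ### A cell -/

/-- **The four cell sums** bound the frozen sums: `F1lo ≤ F(t₁)·2^P`, `F(t₂)·2^P ≤ F2hi`,
`G(t₀)·2^P ≤ G0hi`, `G(t₁)·2^P ≤ G1hi` (`F` frozen at `t₀`, `G` at `t₁`). [folklore] -/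
theorem sums4_spec {P N ℓ : ℕ} {vals : List ℚ} {cds : List CDat} {rds : List RDat}
    (h : List.Forall₂ (CDat.Models P vals ℓ) cds rds) (hok : ∀ r ∈ rds, r.ok) {t₀ t₁ t₂ : ℝ}
    {p0 p1 p2 : List (NI × NI)}
    (h0 : List.Forall₂ (fun pr r => pr.1.mem P (fC r.x r.y t₀) ∧ pr.2.mem P (brR N ℓ t₀ r.x r.y)) p0 rds)
    (h1 : List.Forall₂ (fun pr r => pr.1.mem P (fC r.x r.y t₁) ∧ pr.2.mem P (brR N ℓ t₁ r.x r.y)) p1 rds)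
    (h2 : List.Forall₂ (fun pr r => pr.1.mem P (fC r.x r.y t₂) ∧ pr.2.mem P (brR N ℓ t₂ r.x r.y)) p2 rds) :
    ((sums4 P cds p0 p1 p2).1 : ℝ) ≤ FC rds N ℓ t₀ t₁ * 2 ^ P ∧
    FC rds N ℓ t₀ t₂ * 2 ^ P ≤ ((sums4 P cds p0 p1 p2).2.1 : ℝ) ∧
    GC rds N ℓ t₁ t₀ * 2 ^ P ≤ ((sums4 P cds p0 p1 p2).2.2.1 : ℝ) ∧
    GC rds N ℓ t₁ t₁ * 2 ^ P ≤ ((sums4 P cds p0 p1 p2).2.2.2 : ℝ) := by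
  induction h generalizing p0 p1 p2 with
  | nil =>
    cases h0; cases h1; cases h2
    simp [sums4, FC, GC]
  | @cons d r dtl rtl hd _ ih =>
    cases h0 with | cons ha0 h0' =>
    cases h1 with | cons ha1 h1' =>
    cases h2 with | cons ha2 h2' =>
    obtain ⟨i1, i2, i3, i4⟩ := ih (fun r' hr' => hok r' (List.mem_cons_of_mem _ hr')) h0' h1' h2'
    have hr := hok r List.mem_cons_self
    have hc := hd.cabs
    have m1 := NI.mem_mul (NI.mem_mul hc ha1.1) ha0.2   -- c f(t₁) b(t₀)
    have m2 := NI.mem_mul (NI.mem_mul hc ha2.1) ha0.2   -- c f(t₂) b(t₀)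
    have m3 := NI.mem_mul (NI.mem_mul hc ha0.1) ha1.2   -- c f(t₀) b(t₁)
    have m4 := NI.mem_mul (NI.mem_mul hc ha1.1) ha1.2   -- c f(t₁) b(t₁)
    simp only [sums4, FC, GC, List.map_cons, List.sum_cons, hd.sign]
    cases r.σ
    · simp only [Bool.false_eq_true, ↓reduceIte, Nat.cast_add, zero_add]
      refine ⟨by simpa [FC] using i1, by simpa [FC] using i2, ?_, ?_⟩
      · have := m3.2; have := i3; simp only [GC] at this ⊢; nlinarith [m3.2]
      · have := i4; simp only [GC] at this ⊢; nlinarith [m4.2]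
    · simp only [↓reduceIte, Nat.cast_add, zero_add]
      refine ⟨?_, ?_, by simpa [GC] using i3, by simpa [GC] using i4⟩
      · have := i1; simp only [FC] at this ⊢; nlinarith [m1.1]
      · have := i2; simp only [FC] at this ⊢; nlinarith [m2.2]

/-- **One cell from the four sums.** [folklore] -/
theorem PsiC_nonneg_of_cellOKC {P N ℓ : ℕ} {rds : List RDat} (hok : ∀ r ∈ rds, r.ok) {t₀ t₁ t₂ : ℝ}
    (ht₀ : (ℓ : ℝ) ≤ t₀) (h01 : t₀ < t₁) (h12 : t₁ < t₂) {S : ℕ × ℕ × ℕ × ℕ}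
    (hF1 : (S.1 : ℝ) ≤ FC rds N ℓ t₀ t₁ * 2 ^ P) (hF2 : FC rds N ℓ t₀ t₂ * 2 ^ P ≤ (S.2.1 : ℝ))
    (hG0 : GC rds N ℓ t₁ t₀ * 2 ^ P ≤ (S.2.2.1 : ℝ)) (hG1 : GC rds N ℓ t₁ t₁ * 2 ^ P ≤ (S.2.2.2 : ℝ))
    {H H3 : ℚ} (hH : (H : ℝ) = t₁ - t₀) (hH3 : (H3 : ℝ) = t₂ - t₁) (hc : cellOKC S H H3 = true) :
    ∀ Δ ∈ Icc t₀ t₁, 0 ≤ PsiC rds N ℓ Δ := by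
  simp only [cellOKC, Bool.and_eq_true, decide_eq_true_eq] at hc
  obtain ⟨hc1, hc2⟩ := hc
  have h2P : (0 : ℝ) < 2 ^ P := pow_pos two_pos P
  have hc1' : (S.2.2.2 : ℝ) ≤ S.1 := by exact_mod_cast hc1
  have hc2' : (S.2.2.1 : ℝ) ≤ S.1 + (H : ℝ) / H3 * ((S.1 : ℝ) - S.2.1) := by
    have := hc2
    have : ((S.2.2.1 : ℚ) : ℝ) ≤ (((S.1 : ℚ) + H / H3 * ((S.1 : ℚ) - S.2.1) : ℚ) : ℝ) := by exact_mod_cast this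
    push_cast at this
    exact this
  have hratio : 0 ≤ (H : ℝ) / H3 := by rw [hH, hH3]; exact div_nonneg (by linarith) (by linarith)
  have hend : GC rds N ℓ t₁ t₁ ≤ FC rds N ℓ t₀ t₁ := le_of_mul_le_mul_right (by linarith) h2P
  have hstart : GC rds N ℓ t₁ t₀ ≤ FC rds N ℓ t₀ t₁ +
      (t₁ - t₀) * (FC rds N ℓ t₀ t₁ - FC rds N ℓ t₀ t₂) / (t₂ - t₁) := by
    have k : (H : ℝ) / H3 * ((S.1 : ℝ) - S.2.1) ≤
        (H : ℝ) / H3 * ((FC rds N ℓ t₀ t₁ - FC rds N ℓ t₀ t₂) * 2 ^ P) :=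
      mul_le_mul_of_nonneg_left (by linarith) hratio
    have k2 : GC rds N ℓ t₁ t₀ * 2 ^ P ≤
        (FC rds N ℓ t₀ t₁ + (H : ℝ) / H3 * (FC rds N ℓ t₀ t₁ - FC rds N ℓ t₀ t₂)) * 2 ^ P := by nlinarith
    have k3 := le_of_mul_le_mul_right k2 h2P
    rw [hH, hH3] at k3
    have e : (t₁ - t₀) / (t₂ - t₁) * (FC rds N ℓ t₀ t₁ - FC rds N ℓ t₀ t₂) =
        (t₁ - t₀) * (FC rds N ℓ t₀ t₁ - FC rds N ℓ t₀ t₂) / (t₂ - t₁) := by ring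
    rw [e] at k3; exact k3
  exact PsiC_nonneg_on_cell hok N ℓ ht₀ h01 h12 hend hstart

/-! ### A cut list -/

/-- `List.all` read pointwise. [folklore] -/
theorem of_all_eq_true {α : Type} {l : List α} {p : α → Bool} (h : l.all p = true) :
    ∀ a ∈ l, p a = true := by simpa [List.all_eq_true] using h

/-- **Soundness of the spin checker.** If `checkSpin` passes, `Ψ ≥ 0` on every cell `[T_k, T_{k+1}]`
and hence on `[T₀, T_K]` (data modelled, value list non-negative). [folklore] -/
theorem checkSpin_sound {P N ℓ : ℕ} {vals : List ℚ} (hvals : ∀ q ∈ vals, 0 ≤ q) {cds : List CDat}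
    {rds : List RDat} (h : List.Forall₂ (CDat.Models P vals ℓ) cds rds) (hok : ∀ r ∈ rds, r.ok)
    {T : List ℚ} {extra : ℚ} (hc : checkSpin P N ℓ (vals.map (NI.ofRat P)) cds T extra = true)
    (hT : 2 ≤ T.length) :
    ∀ Δ : ℝ, ((T.getD 0 0 : ℚ) : ℝ) ≤ Δ → Δ ≤ ((T.getD (T.length - 1) 0 : ℚ) : ℝ) → 0 ≤ PsiC rds N ℓ Δ := by
  unfold checkSpin at hc
  simp only [Bool.and_eq_true] at hc
  obtain ⟨⟨hall, hinc⟩, hcells⟩ := hc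
  set Tx := T ++ [extra] with hTx
  have hTxlen : Tx.length = T.length + 1 := by simp [hTx]
  -- point facts
  have hpt : ∀ k, k < Tx.length → dyOK (Tx.getD k 0) = true ∧ (ℓ : ℚ) ≤ Tx.getD k 0 := by
    intro k hk
    have := of_all_eq_true hall (Tx.getD k 0) (by rw [List.getD_eq_getElem _ _ hk]; exact List.getElem_mem hk)
    simpa [Bool.and_eq_true, decide_eq_true_eq] using this
  have hincr : ∀ k, k < T.length → Tx.getD k 0 < Tx.getD (k + 1) 0 := by
    intro k hk
    have := allBelow_spec hinc k hk
    simpa using this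
  -- getD of T versus Tx
  have hTTx : ∀ k, k < T.length → T.getD k 0 = Tx.getD k 0 := by
    intro k hk
    rw [hTx, List.getD_eq_getElem _ _ hk, List.getD_eq_getElem _ _ (by simp; omega),
      List.getElem_append_left hk]
  -- each cell
  have hcell : ∀ k, k < T.length - 1 →
      ∀ Δ ∈ Icc (((Tx.getD k 0 : ℚ)) : ℝ) (((Tx.getD (k + 1) 0 : ℚ)) : ℝ), 0 ≤ PsiC rds N ℓ Δ := by
    intro k hk
    have hk0 : k < Tx.length := by omega
    have hk1 : k + 1 < Tx.length := by omega
    have hk2 : k + 2 < Tx.length := by omega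
    have hc := allBelow_spec hcells k hk
    set PT := Tx.map (pointC P N ℓ (vals.map (NI.ofRat P)) cds) with hPT
    have hP : ∀ j, j < Tx.length → PT.getD j [] = pointC P N ℓ (vals.map (NI.ofRat P)) cds (Tx.getD j 0) := by
      intro j hj
      rw [hPT, List.getD_eq_getElem _ _ (by simpa using hj), List.getElem_map,
        List.getD_eq_getElem _ _ hj]
    rw [hP k hk0, hP (k + 1) hk1, hP (k + 2) hk2] at hc
    have s0 := pointC_spec (N := N) hvals h hok (hpt k hk0).1 (hpt k hk0).2
    have s1 := pointC_spec (N := N) hvals h hok (hpt (k + 1) hk1).1 (hpt (k + 1) hk1).2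
    have s2 := pointC_spec (N := N) hvals h hok (hpt (k + 2) hk2).1 (hpt (k + 2) hk2).2
    obtain ⟨b1, b2, b3, b4⟩ := sums4_spec h hok s0 s1 s2
    have i01 : ((Tx.getD k 0 : ℚ) : ℝ) < ((Tx.getD (k + 1) 0 : ℚ) : ℝ) := by
      exact_mod_cast hincr k (by omega)
    have i12 : ((Tx.getD (k + 1) 0 : ℚ) : ℝ) < ((Tx.getD (k + 2) 0 : ℚ) : ℝ) := by
      exact_mod_cast hincr (k + 1) (by omega)
    have hℓ0 : (ℓ : ℝ) ≤ ((Tx.getD k 0 : ℚ) : ℝ) := by exact_mod_cast (hpt k hk0).2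
    exact PsiC_nonneg_of_cellOKC hok hℓ0 i01 i12 b1 b2 b3 b4 (by push_cast; ring) (by push_cast; ring) hc
  -- cover
  intro Δ hlo hhi
  have hK : 1 ≤ T.length - 1 := by omega
  have hcover := nonneg_of_cells (Ψ := PsiC rds N ℓ) (fun k => (((Tx.getD k 0 : ℚ)) : ℝ)) hK
    (fun k hk => hcell k hk) Δ
  refine hcover ⟨?_, ?_⟩
  · rw [← hTTx 0 (by omega)]; exact hlo
  · rw [← hTTx (T.length - 1) (by omega)]; exact hhi

/-! ### Obligation (C) on the range of a cut list -/

/-- **(C) from the spin checker.** For a point functional with rational nodes in the open square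
(coordinates in `vals`) at `Δ_σ = 1/8` whose above-threshold obligation `PairPositiveAbove φ (1/8) E₀`
holds: if `checkSpin` passes at even spin `ℓ` with truncation order `N ≥ E₀ - T₀` and `T₀ ≥ ℓ`, then
`CellPositive φ (1/8) ℓ T₀ T_K`. PROVED (`checkSpin_sound` + `pointFunctional_QN_eq_PsiC` +
`blockPositive_of_QN_nonneg`). [folklore] -/
theorem cellPositive_of_checkSpin {n : ℕ} (w z zb : Fin n → ℚ) (hz : ∀ k, 0 < z k ∧ z k < 1)
    (hzb : ∀ k, 0 < zb k ∧ zb k < 1) (vals : List ℚ) (hvals : ∀ q ∈ vals, 0 ≤ q)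
    (hv : ∀ k, z k ∈ vals ∧ zb k ∈ vals ∧ 1 - z k ∈ vals ∧ 1 - zb k ∈ vals)
    {E₀ : ℝ} (hpair : PairPositiveAbove
      (pointFunctional (fun k => ((w k : ℚ) : ℝ)) (fun k => ((z k : ℚ) : ℝ)) (fun k => ((zb k : ℚ) : ℝ)))
      (1 / 8) E₀)
    (P depth N ℓ : ℕ) (hℓ : Even ℓ) (T : List ℚ) (extra : ℚ) (hT : 2 ≤ T.length)
    (hℓT : (ℓ : ℚ) ≤ T.getD 0 0) (hN : E₀ ≤ ((T.getD 0 0 : ℚ) : ℝ) + N)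
    (hc : checkSpin P N ℓ (vals.map (NI.ofRat P)) (mkCData P depth ℓ vals w z zb) T extra = true) :
    CellPositive (pointFunctional (fun k => ((w k : ℚ) : ℝ)) (fun k => ((z k : ℚ) : ℝ))
      (fun k => ((zb k : ℚ) : ℝ))) (1 / 8) ℓ ((T.getD 0 0 : ℚ) : ℝ) ((T.getD (T.length - 1) 0 : ℚ) : ℝ) := by
  intro Δ hΔ
  have hz' : ∀ k, ((z k : ℚ) : ℝ) ∈ Ioo (0 : ℝ) 1 := fun k =>
    ⟨by exact_mod_cast (hz k).1, by exact_mod_cast (hz k).2⟩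
  have hzb' : ∀ k, ((zb k : ℚ) : ℝ) ∈ Ioo (0 : ℝ) 1 := fun k =>
    ⟨by exact_mod_cast (hzb k).1, by exact_mod_cast (hzb k).2⟩
  have hφ := evaluationContinuous_pointFunctional (fun k => ((w k : ℚ) : ℝ)) _ _ hz' hzb'
  have hΨ := checkSpin_sound hvals (mkCData_models P depth ℓ vals w z zb hz hzb hv) (realData_ok w z zb hz hzb)
    hc hT Δ hΔ.1 hΔ.2
  rw [← pointFunctional_QN_eq_PsiC w z zb hz hzb hℓ] at hΨ
  have hℓΔ : (ℓ : ℝ) ≤ Δ := le_trans (by exact_mod_cast hℓT) hΔ.1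
  exact blockPositive_of_QN_nonneg hφ hpair hℓΔ (by linarith [hΔ.1]) hΨ

end Summit.CriticalPhenomena.Ising3D.Control2D
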